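/-
Copyright (c) 2026 the pub-hodgecm-mathlib formalisation cell (harness21).  Prover seat hodgecm-mathlib-LH7-p05 (g3) on the L1 VALVE (LEAD F0P6-plan (g15)
BATCH #218), Track B «K2-LIT» ∕ hLiu418 #184♮ = `stmt-HodgeConjecture-24832`, socket #41 KIND 1 a♮, the (L4) count road: the ONE generic arithmetic brick
«THE NUMBER OF PRIMES DIVIDING AN INTEGRAL IDEAL IS AT MOST `log₂` OF ITS NORM» imported by K2Liu-p03 (g8)'s count file C `K2LiuKindOneSingularShellCount`
(`pow_card_Pm_le`, `D`-currency) and by K2E4-p10 (g10)'s (L4) `K2LiuKindOneSingularScalarBound.hGb_of_countLetter`.  THEOREMS ONLY (no `def`, no `instance`,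
no notation, no named-fact hypothesis, no `sorry`); pure Mathlib; lane `--supports stmt-HodgeConjecture-24832 --as helper`.
-/
import Mathlib.NumberTheory.NumberField.Basic
import Mathlib.RingTheory.Ideal.Norm.AbsNorm
import Mathlib.RingTheory.DedekindDomain.AdicValuation
import Mathlib.RingTheory.DedekindDomain.Factorization
import Mathlib.RingTheory.DedekindDomain.Ideal.Lemmas
import Mathlib.Analysis.SpecialFunctions.Log.Base
import Mathlib.Analysis.SpecialFunctions.Pow.Real
import Literature.NumberTheory.LFunctions.AbelianFrobeniusDensity   -- ★ `AbelianDensity.two_le_absNorm` (`N(𝔭) ≥ 2`), reused not restated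
import HarnessLib

/-!
# Crux `HLiu418`, socket #41 KIND 1 a♮, (L4) count road — `K2LiuIdealPrimeCountLetter`: `#{v : v ∣ 𝔞} ≤ log₂ N(𝔞)` AND `c^{#{v ∣ 𝔞}} ≤ N(𝔞)^{log₂ c}`

Cell `hodgecm-mathlib`, crux item hLiu418 = `stmt-HodgeConjecture-24832` (helper lane, count-neutral; closes no socket).  Namespace
`Summit.HodgeConjecture.HodgeConjecture.Cruxes.HLiu418.K2LiuIdealPrimeCountLetter`.

WHY.  The (L4) singular-scalar bound of KIND 1 a♮ carries ONE count letter BY VALUE, `(16∕3)^{#(Pm S h)} ≤ Cp · H(h)^{ap} · (1 + τa S)^{Np} · D^{Nd}` (K1a desk K2E5-p16 (g8)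
01:10:41Z; K2Liu-p03 (g8) 01:11:40Z (ii), `D`-currency): the moving bad-place set `Pm S h = T S h ∖ T₀` of ★ p863805 `K2LiuKindOneSingularTailOfRecord` consists of primes
dividing finitely many integral ideals (denominators of the corner value `σc S`, of the translate `gc S · h`, of `τ(σc S)`), and each factor `c¹_v(s)⁻¹` they cost is `≤ 16∕3`
in norm (★ p863157).  The arithmetic that turns «primes dividing 𝔞» into «a power of `N(𝔞)`» is this file, for an arbitrary number field `K` (applied at `K := L⁺`):
* §1 **`two_pow_card_le_absNorm`**: for a non-zero ideal `I` of `𝓞 K` and any finset `T` of height-one primes each dividing `I`, `2 ^ #T ≤ N(I)` (distinct maximal ideals are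
  pairwise coprime, so `∏_{v∈T} v ∣ I` — Mathlib `IsDedekindDomain.HeightOneSpectrum.inf_pow_eq_prod` — and `N` is multiplicative with `N(v) ≥ 2`);
  **`card_le_log_absNorm`**: `#T ≤ Nat.log 2 (N I)`; **`ncard_setOf_dvd_le_log_absNorm`**: the same for the full set `{v | v ∣ I}` (finite, Mathlib `Ideal.finite_factors`);
  **`rpow_card_le_absNorm_rpow`**: for real `1 ≤ c`, `c ^ #T ≤ (N I : ℝ) ^ log₂ c` — the shape the count letter consumes (`c := 16∕3`).
* §2 (element ∕ valuation doors, the currencies of ★ p863805's witnesses) **`card_le_log_natAbs_norm`**: `x : 𝓞 K`, `x ≠ 0`, every `v ∈ T` divides `(x)` ⇒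
  `#T ≤ Nat.log 2 |N_{K∕ℚ}(x)|`; the doors **`valued_coe_adicCompletion_lt_one_iff_dvd`** ∕ **`valued_algebraMap_adicCompletion_lt_one_iff_dvd`** (`|x|_v < 1` in `K_v`
  iff `v ∣ (x)`, coercion and `algebraMap K K_v` currencies; Mathlib `valuedAdicCompletion_eq_valuation'` + `valuation_lt_one_iff_dvd`) and
  **`card_le_log_natAbs_norm_of_valuation_lt_one`**: the count with the hypothesis read in the `v`-adic completion;
  **`card_le_log_pow_of_natCast`** ∕ **`…_of_valuation_natCast_lt_one`**: for a natural
  denominator `D ≠ 0`, the primes of `K` at which `|D|_v < 1` number at most `Nat.log 2 (D ^ [K:ℚ])` (`N((D)) = D^{[K:ℚ]}`, Mathlib `Ideal.absNorm_span_natCast`);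
  **`rpow_card_le_natCast_rpow`**: hence `c ^ #T ≤ (D : ℝ) ^ ([K:ℚ] · log₂ c)` — the `D^{Nd}` factor of the count letter with `Nd := [L⁺:ℚ] · log₂(16∕3)`.
References: [NeukirchANT1999, Ch. I §3 Thm. (3.3) (prime factorisation of ideals); Ch. I §6 Prop. (6.1) (the absolute norm is multiplicative)];
[CasselsFrohlichANT1967, Ch. II §10 (discrete valuations of a number field ↔ prime ideals)].
HONEST LABEL: HC_CM is proved only modulo the 7 printed citations (2 remaining named inputs: hLiu418 = stmt-HodgeConjecture-24832, h413 = stmt-HodgeConjecture-24833) until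
rung 0 closes; count-neutral helper (`--supports stmt-HodgeConjecture-24832 --as helper`), closes no socket, moves no counter.
-/

set_option autoImplicit false
set_option linter.dupNamespace false -- the mandated namespace repeats `HodgeConjecture.HodgeConjecture`

noncomputable section

open NumberField IsDedekindDomain

namespace Summit.HodgeConjecture.HodgeConjecture.Cruxes.HLiu418.K2LiuIdealPrimeCountLetter

variable {K : Type*} [Field K] [NumberField K]

/-! ## §1 Primes dividing an integral ideal versus its absolute norm -/

/-- Distinct height-one primes each dividing `I` divide `I` jointly: `∏_{v ∈ T} v ∣ I` (pairwise comaximality in a Dedekind domain).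
[cite: NeukirchANT1999, Ch. I §3 Thm. (3.3)] -/
theorem prod_asIdeal_dvd {I : Ideal (𝓞 K)} (T : Finset (HeightOneSpectrum (𝓞 K))) (hT : ∀ v ∈ T, v.asIdeal ∣ I) :
    (∏ v ∈ T, v.asIdeal) ∣ I := by
  classical
  have h := IsDedekindDomain.HeightOneSpectrum.inf_pow_eq_prod (R := 𝓞 K) T (fun _ => 1) id (fun i _ j _ hij => hij)
  simp only [id, pow_one] at h
  rw [Ideal.dvd_iff_le, ← h]
  exact Finset.le_inf fun v hv => Ideal.le_of_dvd (hT v hv)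

/-- **`2 ^ #{v ∈ T} ≤ N(I)`**: a non-zero integral ideal of a number field has at most `log₂ N(I)` prime divisors — product form.  For `I ≠ ⊥` and a finset `T` of height-one
primes each dividing `I`: `∏_{v∈T} v ∣ I`, the absolute norm is multiplicative and `≥ 2` on primes. [cite: NeukirchANT1999, Ch. I §3 Thm. (3.3); Ch. I §6 Prop. (6.1)] -/
theorem two_pow_card_le_absNorm {I : Ideal (𝓞 K)} (hI : I ≠ ⊥) (T : Finset (HeightOneSpectrum (𝓞 K))) (hT : ∀ v ∈ T, v.asIdeal ∣ I) :
    2 ^ T.card ≤ Ideal.absNorm I := by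
  classical
  have hdvd : (∏ v ∈ T, Ideal.absNorm v.asIdeal) ∣ Ideal.absNorm I := by
    rw [← map_prod]
    exact Ideal.absNorm_dvd_absNorm_of_le (Ideal.le_of_dvd (prod_asIdeal_dvd T hT))
  have hI0 : Ideal.absNorm I ≠ 0 := by rwa [Ne, Ideal.absNorm_eq_zero_iff]
  calc 2 ^ T.card = ∏ _v ∈ T, 2 := (Finset.prod_const 2).symm
    _ ≤ ∏ v ∈ T, Ideal.absNorm v.asIdeal :=
        Finset.prod_le_prod (fun _ _ => Nat.zero_le _) fun v _ => Literature.NumberTheory.LFunctions.AbelianDensity.two_le_absNorm K v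
    _ ≤ Ideal.absNorm I := Nat.le_of_dvd (Nat.pos_of_ne_zero hI0) hdvd

/-- **`#{v ∈ T} ≤ log₂ N(I)`**: for `I ≠ ⊥` and a finset `T` of height-one primes of `𝓞 K` each dividing `I`, `#T ≤ Nat.log 2 (N I)`.
[cite: NeukirchANT1999, Ch. I §3 Thm. (3.3); Ch. I §6 Prop. (6.1)] -/
theorem card_le_log_absNorm {I : Ideal (𝓞 K)} (hI : I ≠ ⊥) (T : Finset (HeightOneSpectrum (𝓞 K))) (hT : ∀ v ∈ T, v.asIdeal ∣ I) :
    T.card ≤ Nat.log 2 (Ideal.absNorm I) :=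
  Nat.le_log_of_pow_le one_lt_two (two_pow_card_le_absNorm hI T hT)

/-- The set of height-one primes dividing a non-zero integral ideal is finite (Mathlib `Ideal.finite_factors`) and has at most `log₂ N(I)` elements.
[cite: NeukirchANT1999, Ch. I §3 Thm. (3.3); Ch. I §6 Prop. (6.1)] -/
theorem ncard_setOf_dvd_le_log_absNorm {I : Ideal (𝓞 K)} (hI : I ≠ ⊥) :
    {v : HeightOneSpectrum (𝓞 K) | v.asIdeal ∣ I}.ncard ≤ Nat.log 2 (Ideal.absNorm I) := by
  have hfin : {v : HeightOneSpectrum (𝓞 K) | v.asIdeal ∣ I}.Finite := Ideal.finite_factors hI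
  rw [Set.ncard_eq_toFinset_card _ hfin]
  exact card_le_log_absNorm hI _ fun v hv => hfin.mem_toFinset.1 hv

/-- **THE COUNT LETTER'S SHAPE `c ^ #{v ∈ T} ≤ N(I) ^ log₂ c`** (real `c ≥ 1`; at `c := 16∕3` this is the `(16∕3)^{#Pm} ≤ N^{log₂(16∕3)}` step of the (L4) count letter):
from `2 ^ #T ≤ N(I)` and `c = 2^{log₂ c}`. [cite: NeukirchANT1999, Ch. I §6 Prop. (6.1)] -/
theorem rpow_card_le_absNorm_rpow {I : Ideal (𝓞 K)} (hI : I ≠ ⊥) (T : Finset (HeightOneSpectrum (𝓞 K))) (hT : ∀ v ∈ T, v.asIdeal ∣ I)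
    {c : ℝ} (hc : 1 ≤ c) :
    c ^ T.card ≤ (Ideal.absNorm I : ℝ) ^ Real.logb 2 c := by
  have h2 : (2 : ℝ) ^ (T.card : ℝ) ≤ (Ideal.absNorm I : ℝ) := by
    rw [Real.rpow_natCast]
    exact_mod_cast two_pow_card_le_absNorm hI T hT
  have hlogb : 0 ≤ Real.logb 2 c := Real.logb_nonneg one_lt_two hc
  have hc0 : 0 < c := lt_of_lt_of_le one_pos hc
  calc c ^ T.card = ((2 : ℝ) ^ Real.logb 2 c) ^ (T.card : ℝ) := by
        rw [Real.rpow_natCast, Real.rpow_logb two_pos (by norm_num) hc0]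
    _ = ((2 : ℝ) ^ (T.card : ℝ)) ^ Real.logb 2 c := by
        rw [← Real.rpow_mul zero_le_two, mul_comm, Real.rpow_mul zero_le_two]
    _ ≤ (Ideal.absNorm I : ℝ) ^ Real.logb 2 c := Real.rpow_le_rpow (by positivity) h2 hlogb

/-! ## §2 Element and valuation doors -/

/-- Element form: for `x : 𝓞 K`, `x ≠ 0`, and a finset `T` of height-one primes each dividing `(x)`, `#T ≤ Nat.log 2 |N_{K∕ℚ}(x)|`
(Mathlib `Ideal.absNorm_span_singleton`). [cite: NeukirchANT1999, Ch. I §3 Thm. (3.3); Ch. I §6 Prop. (6.1)] -/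
theorem card_le_log_natAbs_norm {x : 𝓞 K} (hx : x ≠ 0) (T : Finset (HeightOneSpectrum (𝓞 K))) (hT : ∀ v ∈ T, v.asIdeal ∣ Ideal.span {x}) :
    T.card ≤ Nat.log 2 (Algebra.norm ℤ x).natAbs := by
  rw [← Ideal.absNorm_span_singleton]
  exact card_le_log_absNorm (by rwa [Ne, Ideal.span_singleton_eq_bot]) T hT

/-- Element form, real-power shape: `c ^ #T ≤ |N_{K∕ℚ}(x)| ^ log₂ c` for `1 ≤ c`. [cite: NeukirchANT1999, Ch. I §6 Prop. (6.1)] -/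
theorem rpow_card_le_natAbs_norm_rpow {x : 𝓞 K} (hx : x ≠ 0) (T : Finset (HeightOneSpectrum (𝓞 K))) (hT : ∀ v ∈ T, v.asIdeal ∣ Ideal.span {x})
    {c : ℝ} (hc : 1 ≤ c) :
    c ^ T.card ≤ ((Algebra.norm ℤ x).natAbs : ℝ) ^ Real.logb 2 c := by
  have h := rpow_card_le_absNorm_rpow (I := Ideal.span {x}) (by rwa [Ne, Ideal.span_singleton_eq_bot]) T hT hc
  rwa [Ideal.absNorm_span_singleton] at h

/-- **VALUATION DOOR** (coercion form): for `x : 𝓞 K`, the `v`-adic absolute value of `x` read in the completion `K_v` is `< 1` iff `v ∣ (x)`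
(Mathlib `valuedAdicCompletion_eq_valuation'`, `valuation_lt_one_iff_dvd`). [cite: CasselsFrohlichANT1967, Ch. II §10] -/
theorem valued_coe_adicCompletion_lt_one_iff_dvd (v : HeightOneSpectrum (𝓞 K)) (x : 𝓞 K) :
    Valued.v (((x : K) : v.adicCompletion K)) < 1 ↔ v.asIdeal ∣ Ideal.span {x} := by
  rw [HeightOneSpectrum.valuedAdicCompletion_eq_valuation']
  exact HeightOneSpectrum.valuation_lt_one_iff_dvd v x

/-- **VALUATION DOOR** (`algebraMap` form, the currency of the K2Liu place-set letters `Valued.v (algebraMap L⁺ L⁺_v t)`): for `x : 𝓞 K`,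
`|x|_v < 1` in `K_v` iff `v ∣ (x)`. [cite: CasselsFrohlichANT1967, Ch. II §10] -/
theorem valued_algebraMap_adicCompletion_lt_one_iff_dvd (v : HeightOneSpectrum (𝓞 K)) (x : 𝓞 K) :
    Valued.v (algebraMap K (v.adicCompletion K) (x : K)) < 1 ↔ v.asIdeal ∣ Ideal.span {x} := by
  rw [HeightOneSpectrum.algebraMap_adicCompletion, Function.comp_apply, Algebra.algebraMap_self_apply]
  exact valued_coe_adicCompletion_lt_one_iff_dvd v x

/-- An integer has `|x|_v ≤ 1` at every finite place (`algebraMap` form). [cite: CasselsFrohlichANT1967, Ch. II §10] -/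
theorem valued_algebraMap_adicCompletion_le_one (v : HeightOneSpectrum (𝓞 K)) (x : 𝓞 K) :
    Valued.v (algebraMap K (v.adicCompletion K) (x : K)) ≤ 1 := by
  rw [HeightOneSpectrum.algebraMap_adicCompletion, Function.comp_apply, Algebra.algebraMap_self_apply,
    HeightOneSpectrum.valuedAdicCompletion_eq_valuation']
  exact HeightOneSpectrum.valuation_le_one v x

/-- Valuation form: for `x : 𝓞 K`, `x ≠ 0`, and a finset `T` of places with `|x|_v < 1` (read in `K_v`), `#T ≤ Nat.log 2 |N_{K∕ℚ}(x)|`.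
[cite: CasselsFrohlichANT1967, Ch. II §10] [cite: NeukirchANT1999, Ch. I §6 Prop. (6.1)] -/
theorem card_le_log_natAbs_norm_of_valuation_lt_one {x : 𝓞 K} (hx : x ≠ 0) (T : Finset (HeightOneSpectrum (𝓞 K)))
    (hT : ∀ v ∈ T, Valued.v (algebraMap K (v.adicCompletion K) (x : K)) < 1) :
    T.card ≤ Nat.log 2 (Algebra.norm ℤ x).natAbs :=
  card_le_log_natAbs_norm hx T fun v hv => (valued_algebraMap_adicCompletion_lt_one_iff_dvd v x).1 (hT v hv)

/-- Valuation form, real-power shape: `c ^ #T ≤ |N_{K∕ℚ}(x)| ^ log₂ c` for `1 ≤ c` when `|x|_v < 1` on `T`.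
[cite: CasselsFrohlichANT1967, Ch. II §10] [cite: NeukirchANT1999, Ch. I §6 Prop. (6.1)] -/
theorem rpow_card_le_natAbs_norm_rpow_of_valuation_lt_one {x : 𝓞 K} (hx : x ≠ 0) (T : Finset (HeightOneSpectrum (𝓞 K)))
    (hT : ∀ v ∈ T, Valued.v (algebraMap K (v.adicCompletion K) (x : K)) < 1) {c : ℝ} (hc : 1 ≤ c) :
    c ^ T.card ≤ ((Algebra.norm ℤ x).natAbs : ℝ) ^ Real.logb 2 c :=
  rpow_card_le_natAbs_norm_rpow hx T (fun v hv => (valued_algebraMap_adicCompletion_lt_one_iff_dvd v x).1 (hT v hv)) hc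

/-- **NATURAL DENOMINATORS** (the `D`-currency): for `D : ℕ`, `D ≠ 0`, the height-one primes of `K` dividing `(D)` number at most `Nat.log 2 (D ^ [K:ℚ])`
(`N((D)) = D^{[K:ℚ]}`, Mathlib `Ideal.absNorm_span_natCast`, `RingOfIntegers.rank`). [cite: NeukirchANT1999, Ch. I §6 Prop. (6.1)] -/
theorem card_le_log_pow_of_natCast {D : ℕ} (hD : D ≠ 0) (T : Finset (HeightOneSpectrum (𝓞 K)))
    (hT : ∀ v ∈ T, v.asIdeal ∣ Ideal.span {(D : 𝓞 K)}) :
    T.card ≤ Nat.log 2 (D ^ Module.finrank ℚ K) := by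
  have h := card_le_log_absNorm (I := Ideal.span {(D : 𝓞 K)}) (by
    rw [Ne, Ideal.span_singleton_eq_bot]
    exact_mod_cast hD) T hT
  rwa [Ideal.absNorm_span_natCast, RingOfIntegers.rank] at h

/-- Natural denominators, valuation door: `|D|_v < 1` on `T` (read in `K_v`) ⇒ `#T ≤ Nat.log 2 (D ^ [K:ℚ])`.
[cite: CasselsFrohlichANT1967, Ch. II §10] [cite: NeukirchANT1999, Ch. I §6 Prop. (6.1)] -/
theorem card_le_log_pow_of_valuation_natCast_lt_one {D : ℕ} (hD : D ≠ 0) (T : Finset (HeightOneSpectrum (𝓞 K)))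
    (hT : ∀ v ∈ T, Valued.v (algebraMap K (v.adicCompletion K) (D : K)) < 1) :
    T.card ≤ Nat.log 2 (D ^ Module.finrank ℚ K) :=
  card_le_log_pow_of_natCast hD T fun v hv =>
    (valued_algebraMap_adicCompletion_lt_one_iff_dvd v (D : 𝓞 K)).1
      (by rw [RingOfIntegers.coe_eq_algebraMap, map_natCast]; exact hT v hv)

/-- **THE `D^{Nd}` FACTOR**: for `D : ℕ`, `D ≠ 0`, real `1 ≤ c`, and a finset `T` of primes dividing `(D)`, `c ^ #T ≤ (D : ℝ) ^ ([K:ℚ] · log₂ c)`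
(so the count letter's denominator factor is `D^{Nd}` with `Nd := [L⁺:ℚ] · log₂(16∕3)`). [cite: NeukirchANT1999, Ch. I §6 Prop. (6.1)] -/
theorem rpow_card_le_natCast_rpow {D : ℕ} (hD : D ≠ 0) (T : Finset (HeightOneSpectrum (𝓞 K)))
    (hT : ∀ v ∈ T, v.asIdeal ∣ Ideal.span {(D : 𝓞 K)}) {c : ℝ} (hc : 1 ≤ c) :
    c ^ T.card ≤ (D : ℝ) ^ ((Module.finrank ℚ K : ℝ) * Real.logb 2 c) := by
  have h := rpow_card_le_absNorm_rpow (I := Ideal.span {(D : 𝓞 K)}) (by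
    rw [Ne, Ideal.span_singleton_eq_bot]
    exact_mod_cast hD) T hT hc
  rw [Ideal.absNorm_span_natCast, RingOfIntegers.rank, Nat.cast_pow] at h
  rwa [Real.rpow_mul (Nat.cast_nonneg D), Real.rpow_natCast]

/-- The `D^{Nd}` factor through the valuation door: `|D|_v < 1` on `T` ⇒ `c ^ #T ≤ (D : ℝ) ^ ([K:ℚ] · log₂ c)`.
[cite: CasselsFrohlichANT1967, Ch. II §10] [cite: NeukirchANT1999, Ch. I §6 Prop. (6.1)] -/
theorem rpow_card_le_natCast_rpow_of_valuation_lt_one {D : ℕ} (hD : D ≠ 0) (T : Finset (HeightOneSpectrum (𝓞 K)))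
    (hT : ∀ v ∈ T, Valued.v (algebraMap K (v.adicCompletion K) (D : K)) < 1) {c : ℝ} (hc : 1 ≤ c) :
    c ^ T.card ≤ (D : ℝ) ^ ((Module.finrank ℚ K : ℝ) * Real.logb 2 c) :=
  rpow_card_le_natCast_rpow hD T (fun v hv =>
    (valued_algebraMap_adicCompletion_lt_one_iff_dvd v (D : 𝓞 K)).1
      (by rw [RingOfIntegers.coe_eq_algebraMap, map_natCast]; exact hT v hv)) hc

end Summit.HodgeConjecture.HodgeConjecture.Cruxes.HLiu418.K2LiuIdealPrimeCountLetter

end
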